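import Summits.Langlands.Langlands.Theorems.SqrtFiveQuarticCoversBorelFiveX0FiveAlgebra
import Summits.Langlands.Langlands.Theorems.SqrtFiveQuarticCoversBorelThreeDivisionPolynomial
import Literature.NumberTheory.EllipticCurves.DivisionPolynomialTorsion

/-!
# Route `SqrtFiveQuarticCovers`, crux `BoxBorelFive` (stmt-Langlands-17835): a Borel mod-`5` framing
# gives a `K`-point of `X₀(5)` over `j(E)` — `∃ h ∈ K, c₄³·h = (h² + 10h + 5)³·Δ`

The Galois / group-law wrapper of `…BorelFiveX0FiveAlgebra` (p800654).  For the `b5`-binder of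
`BoxBorelFive` VERBATIM (a framing `ρ̄ : Γ_K →ₜ* GL₂(𝔽₅)` of `E[5]` with equivariant
`e : E[5](K̄) ≃+ 𝔽₅²` and all `(1,0)` entries zero):

1. `P = e⁻¹(1,0)` is a point of order `5` with `σ • P = ρ̄(σ)₀₀ · P`, so `σ(x(P)) ∈ {x(P), x(2P)}`
   (`ρ̄₀₀ ∈ {±1}` fixes `x(P)`, `ρ̄₀₀ ∈ {±2}` sends it to `x(±2P) = x(2P)`);
2. group law: `x(2P)·υ = x·υ − Ψ₃` (the tree's `addX_self_sub_mul_sq`, `υ = ψ₂² = (2y + a₁x + a₃)²`),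
   applied to `P` and to `2P`; with `4P = −P` (`5P = O`) and the doubling identities `upsilon_double`,
   `Ψ₃_double` this yields the `5`-division relation `P₄(x)υ(x)² = Ψ₃(x)³` at `x = x(P)`;
3. algebra (p800654): `h(x) := τ(υ⁴ − Ψ₃³)/(Ψ₃²υ²) − 11` satisfies `c₄³·h = (h²+10h+5)³·Δ`;
4. invariance `h(x(2P)) = h(x(P))` (`tau_sq_add_four_Ψ₃` + the `5`-division relation; explicit
   cofactors), hence `σ h = h` for all `σ ∈ Gal(K̄/K)`, i.e. `h ∈ K` (`K̄^{Γ_K} = K`).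

Main statements: `exists_X0_five_hauptmodul_of_borelFive` (perfect field `K`, curve `V/K`; no
`Δ ≠ 0` hypothesis is needed — the framing of `V[5]` supplies all non-vanishing) and `exists_X0_five_hauptmodul_of_borelFive_framing` (number field, `E / 𝓞 K`, the cruxes'
`b5`-binder VERBATIM): `∃ h : K, c₄(E⊗K)³·h = (h² + 10h + 5)³·Δ(E⊗K)` — `j(E) = (h²+10h+5)³/h`,
`[E] ∈ j(X₀(5)(K))`, the moduli meaning of Box's `b5`-curves' common factor `X(b5) = X₀(5)`.
Everything is proved; no named fact.  HONEST STATUS: helper of stmt-Langlands-17835 (N1 debt); the crux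
stays conditional on `Box2022_theorem1_5_modular`; nothing here proves modularity of any curve.

References: J. H. Silverman, GTM 106 (2009), III.§2 (group law), Ex. 3.7 (`ψₙ`), I.§1 (descent);
F. Klein (1884) / R. Fricke (1922) (`X₀(5)`); [Box2022] §1.1, Thm. 1.5.
-/

noncomputable section

set_option linter.dupNamespace false -- project-wide option (lakefile weak.linter.dupNamespace); `Summit.Langlands.Langlands` is the mandated namespace

open scoped Classical
open scoped Matrix NumberField

namespace Summit.Langlands.Langlands.Theorems.SqrtFiveQuarticCovers

open WeierstrassCurve Literature.NumberTheory.GaloisRepresentations Polynomial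

/-- `ψ₂² = υ`: for an affine point `(x, y)` on `W`, `(y − (−y − a₁x − a₃))² = 4x³ + b₂x² + 2b₄x + b₆`.
[cite: SilvermanAEC2009, III.§2] -/
theorem sq_sub_negY_eq_upsilon {L : Type*} [Field L] (W : WeierstrassCurve L) {x y : L}
    (h : W.toAffine.Equation x y) :
    (y - W.toAffine.negY x y) ^ 2 = 4 * x ^ 3 + W.b₂ * x ^ 2 + 2 * W.b₄ * x + W.b₆ := by
  have heq := (Affine.equation_iff ..).mp h
  simp only [Affine.negY, WeierstrassCurve.b₂, WeierstrassCurve.b₄, WeierstrassCurve.b₆]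
  linear_combination 4 * heq

/-- **Doubling against `υ` and `Ψ₃`**: for an affine point `P = (x, y)` with `2P ≠ O`,
`x(2P)·υ(x) = x·υ(x) − Ψ₃(x)` (the tree's `addX_self_sub_mul_sq` with `ψ₂² = υ`).
[cite: SilvermanAEC2009, III.2.3(d), Ex. 3.7] -/
theorem addX_self_mul_upsilon {L : Type*} [Field L] (W : WeierstrassCurve L) {x y : L}
    (h : W.toAffine.Equation x y) (hy : y ≠ W.toAffine.negY x y) :
    W.toAffine.addX x x (W.toAffine.slope x x y y) * (4 * x ^ 3 + W.b₂ * x ^ 2 + 2 * W.b₄ * x + W.b₆) =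
      x * (4 * x ^ 3 + W.b₂ * x ^ 2 + 2 * W.b₄ * x + W.b₆)
        - (3 * x ^ 4 + W.b₂ * x ^ 3 + 3 * W.b₄ * x ^ 2 + 3 * W.b₆ * x + W.b₈) := by
  have key := WeierstrassCurve.addX_self_sub_mul_sq (V := W) h hy
  rw [sq_sub_negY_eq_upsilon W h, eval_Ψ₃_eq] at key
  linear_combination key

/-- **Invariance of the `X₀(5)` hauptmodul under `P ↦ 2P`** (atoms).  With the `5`-division relation
`τwυ² = υ⁴ + w³`, `τ² + 4w = mυ` (`m = 12x + b₂`), `υ, w, τw − υ² ≠ 0`, and the doubled atoms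
`T₂υ² = τυ² − mwυ + 6w²`, `U₂υ³ = (τw − υ²)²`, `W₂υ⁴ = w((τw−υ²)υ² − w³ − (τw−υ²)²)`:
`T₂(U₂⁴ − W₂³)/(W₂²U₂²) = τ(υ⁴ − w³)/(w²υ²)`. [folklore] -/
theorem X0_five_hauptmodul_invariant {L : Type*} [Field L] {τ w υ m T₂ U₂ W₂ : L}
    (hυ : υ ≠ 0) (hw : w ≠ 0) (hP : τ * w - υ ^ 2 ≠ 0)
    (hIII : τ * w * υ ^ 2 = υ ^ 4 + w ^ 3) (hA3 : τ ^ 2 + 4 * w = m * υ)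
    (hT : T₂ * υ ^ 2 = τ * υ ^ 2 - m * w * υ + 6 * w ^ 2)
    (hU : U₂ * υ ^ 3 = (τ * w - υ ^ 2) ^ 2)
    (hW : W₂ * υ ^ 4 = w * ((τ * w - υ ^ 2) * υ ^ 2 - w ^ 3 - (τ * w - υ ^ 2) ^ 2)) :
    T₂ * (U₂ ^ 4 - W₂ ^ 3) / (W₂ ^ 2 * U₂ ^ 2) = τ * (υ ^ 4 - w ^ 3) / (w ^ 2 * υ ^ 2) := by
  have hW' : W₂ * υ ^ 4 = -(w * (τ * w - υ ^ 2) ^ 2) := by linear_combination hW + w * hIII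
  have hU0 : U₂ ≠ 0 := by
    intro h0; rw [h0, zero_mul] at hU; exact pow_ne_zero 2 hP hU.symm
  have hW0 : W₂ ≠ 0 := by
    intro h0; rw [h0, zero_mul, eq_comm, neg_eq_zero] at hW'
    exact mul_ne_zero hw (pow_ne_zero 2 hP) hW'
  rw [div_eq_div_iff (mul_ne_zero (pow_ne_zero 2 hW0) (pow_ne_zero 2 hU0))
    (mul_ne_zero (pow_ne_zero 2 hw) (pow_ne_zero 2 hυ))]
  have hυ14 : υ ^ 14 ≠ 0 := pow_ne_zero 14 hυ
  apply mul_left_cancel₀ hυ14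
  have eL : υ ^ 14 * (T₂ * (U₂ ^ 4 - W₂ ^ 3) * (w ^ 2 * υ ^ 2)) =
      (T₂ * υ ^ 2) * ((U₂ * υ ^ 3) ^ 4 - (W₂ * υ ^ 4) ^ 3) * (w ^ 2 * υ ^ 2) := by ring
  have eR : υ ^ 14 * (τ * (υ ^ 4 - w ^ 3) * (W₂ ^ 2 * U₂ ^ 2)) =
      τ * (υ ^ 4 - w ^ 3) * (W₂ * υ ^ 4) ^ 2 * (U₂ * υ ^ 3) ^ 2 := by ring
  rw [eL, eR, hT, hU, hW']
  linear_combination (τ * w ^ 4 * υ ^ 2 * (τ * w - υ ^ 2) ^ 7) * hA3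
    + (-(w ^ 2 * (τ * w - υ ^ 2) ^ 6 * (2 * τ * υ ^ 2 * (τ * w - υ ^ 2)
        + (τ * υ ^ 2 - m * w * υ + 6 * w ^ 2) * υ ^ 2 + τ * (τ * w - υ ^ 2) ^ 2))) * hIII

/-- **A Borel mod-`5` framing gives a `K`-point of `X₀(5)` over `j`.**  Let `K` be a perfect field,
`V` a Weierstrass curve over `K`, `ρ̄ : Γ_K →ₜ* GL₂(𝔽₅)` with an equivariant framing
`e : V[5](K̄) ≃+ 𝔽₅²` and all `(1,0)` entries zero.  Then `∃ h : K, c₄(V)³·h = (h² + 10h + 5)³·Δ(V)`,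
i.e. `j(V) = (h²+10h+5)³/h` is the image of a `K`-point of `X₀(5)`.  See the module docstring for the
proof. [cite: SilvermanAEC2009, III.§2, Ex. 3.7, I.§1] [cite: Box2022, §1.1] -/
theorem exists_X0_five_hauptmodul_of_borelFive {K : Type} [Field K] [PerfectField K]
    (V : WeierstrassCurve K) (ρ : FramedGaloisRep K (ZMod 5) 2)
    (e : V.geomTorsion ((5 : ℕ) : ℤ) ≃+ (Fin 2 → ZMod 5))
    (he : ∀ (σ : Field.absoluteGaloisGroup K) (P : V.geomTorsion ((5 : ℕ) : ℤ)),
      e (σ • P) = ((ρ σ : GL (Fin 2) (ZMod 5)) : Matrix (Fin 2) (Fin 2) (ZMod 5)) *ᵥ (e P))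
    (hB : ∀ σ : Field.absoluteGaloisGroup K,
      (((ρ σ : GL (Fin 2) (ZMod 5)) : Matrix (Fin 2) (Fin 2) (ZMod 5)) 1 0 = 0)) :
    ∃ h : K, V.c₄ ^ 3 * h = (h ^ 2 + 10 * h + 5) ^ 3 * V.Δ := by
  have d0 : ∀ b : ZMod 5, b = 0 ∨ b = 1 ∨ b = 2 ∨ b = 3 ∨ b = 4 := by decide
  have d2 : ∀ c : ZMod 5, (2 : ZMod 5) * c = c + c := by decide
  have d3 : ∀ c : ZMod 5, (3 : ZMod 5) * c = -(c + c) := by decide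
  have d4 : ∀ c : ZMod 5, (4 : ZMod 5) * c = -c := by decide
  haveI : IsGalois K (AlgebraicClosure K) := {}
  set L := AlgebraicClosure K with hL
  have inj : Function.Injective (algebraMap K L) := (algebraMap K L).injective
  set W := V.baseChange L with hWdef
  have hb₂ : W.b₂ = algebraMap K L V.b₂ := by rw [hWdef, WeierstrassCurve.baseChange, WeierstrassCurve.map_b₂]
  have hb₄ : W.b₄ = algebraMap K L V.b₄ := by rw [hWdef, WeierstrassCurve.baseChange, WeierstrassCurve.map_b₄]
  have hb₆ : W.b₆ = algebraMap K L V.b₆ := by rw [hWdef, WeierstrassCurve.baseChange, WeierstrassCurve.map_b₆]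
  have hb₈ : W.b₈ = algebraMap K L V.b₈ := by rw [hWdef, WeierstrassCurve.baseChange, WeierstrassCurve.map_b₈]
  have hc₄ : W.c₄ = algebraMap K L V.c₄ := by rw [hWdef, WeierstrassCurve.baseChange, WeierstrassCurve.map_c₄]
  have hΔ' : W.Δ = algebraMap K L V.Δ := by rw [hWdef, WeierstrassCurve.baseChange, WeierstrassCurve.map_Δ]
  -- the framed point
  set v : Fin 2 → ZMod 5 := Pi.single 0 1 with hv
  set P : V.geomTorsion ((5 : ℕ) : ℤ) := e.symm v with hPdef
  have heP : e P = v := e.apply_symm_apply v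
  have hv0 : v ≠ 0 := by
    intro h; have := congrFun h 0; simp [hv] at this; exact absurd this (by decide)
  have hP0 : P ≠ 0 := by
    intro h; apply hv0; rw [← heP, h, map_zero]
  -- `σ • P ∈ {P, -P, 2P, -2P}`
  have hσ : ∀ σ : Field.absoluteGaloisGroup K,
      σ • P = P ∨ σ • P = -P ∨ σ • P = P + P ∨ σ • P = -(P + P) := by
    intro σ
    have h1 : e (σ • P) = (((ρ σ : GL (Fin 2) (ZMod 5)) : Matrix (Fin 2) (Fin 2) (ZMod 5)) 0 0) • v := by
      rw [he, heP]
      ext i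
      fin_cases i
      · simp [hv, Matrix.mulVec, dotProduct, Fin.sum_univ_two]
      · simp [hv, Matrix.mulVec, dotProduct, Fin.sum_univ_two, hB σ]
    generalize ha : (((ρ σ : GL (Fin 2) (ZMod 5)) : Matrix (Fin 2) (Fin 2) (ZMod 5)) 0 0) = a at h1
    rcases d0 a with h0 | h1' | h2 | h3 | h4
    · exfalso
      rw [h0, zero_smul] at h1
      have : σ • P = 0 := by apply e.injective; rw [h1, map_zero]
      exact hP0 ((smul_eq_zero_iff_eq σ).1 this)
    · left; apply e.injective; rw [h1, h1', one_smul, heP]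
    · right; right; left
      apply e.injective
      rw [h1, map_add, heP, h2]
      ext i; simp only [Pi.smul_apply, smul_eq_mul, Pi.add_apply]; exact d2 (v i)
    · right; right; right
      apply e.injective
      rw [h1, map_neg, map_add, heP, h3]
      ext i; simp only [Pi.smul_apply, smul_eq_mul, Pi.neg_apply, Pi.add_apply]; exact d3 (v i)
    · right; left
      apply e.injective
      rw [h1, map_neg, heP, h4]
      ext i; simp only [Pi.smul_apply, smul_eq_mul, Pi.neg_apply]; exact d4 (v i)
  -- the underlying point `Q ∈ V(K̄)` of order `5`
  obtain ⟨Q, hQ⟩ : ∃ Q : W.toAffine.Point, Q = (P : V.geomPoints) := ⟨_, rfl⟩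
  have hQ0 : Q ≠ 0 := by
    intro h; apply hP0; apply Subtype.ext; rw [← hQ]; exact h
  have hQ5 : (5 : ℕ) • Q = 0 := by
    rw [hQ, ← natCast_zsmul]
    exact (Submodule.mem_torsionBy_iff _ _).1 P.2
  -- Galois action transported to `Q`
  have hσQ : ∀ σ : AlgebraicClosure K ≃ₐ[K] AlgebraicClosure K,
      σ • Q = Q ∨ σ • Q = -Q ∨ σ • Q = Q + Q ∨ σ • Q = -(Q + Q) := by
    intro σ
    rw [hQ]
    rcases hσ σ with h | h | h | h
    · left; exact congrArg (fun T : V.geomTorsion ((5 : ℕ) : ℤ) => (T : V.geomPoints)) h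
    · right; left; exact congrArg (fun T : V.geomTorsion ((5 : ℕ) : ℤ) => (T : V.geomPoints)) h
    · right; right; left; exact congrArg (fun T : V.geomTorsion ((5 : ℕ) : ℤ) => (T : V.geomPoints)) h
    · right; right; right; exact congrArg (fun T : V.geomTorsion ((5 : ℕ) : ℤ) => (T : V.geomPoints)) h
  clear hσ hQ
  -- coordinates of `Q`
  rcases Q with _ | ⟨x₁, y₁, h₁⟩
  · exact absurd rfl hQ0
  -- `Q` is not `2`-torsion
  have hy₁ : y₁ ≠ W.toAffine.negY x₁ y₁ := by
    intro hy
    have h2 : (Affine.Point.some x₁ y₁ h₁ : W.toAffine.Point) + Affine.Point.some x₁ y₁ h₁ = 0 :=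
      Affine.Point.add_self_of_Y_eq hy
    apply hQ0
    have : (Affine.Point.some x₁ y₁ h₁ : W.toAffine.Point) =
        5 • Affine.Point.some x₁ y₁ h₁ - 2 • (Affine.Point.some x₁ y₁ h₁ + Affine.Point.some x₁ y₁ h₁) := by
      abel
    rw [this, hQ5, h2, nsmul_zero, sub_zero]
  -- `2Q = (x₂, y₂)`
  have h2Q := Affine.Point.add_self_of_Y_ne (h₁ := h₁) hy₁
  obtain ⟨x₂, hx₂⟩ : ∃ x₂ : L, x₂ = W.toAffine.addX x₁ x₁ (W.toAffine.slope x₁ x₁ y₁ y₁) := ⟨_, rfl⟩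
  obtain ⟨y₂, hy₂d⟩ : ∃ y₂ : L, y₂ = W.toAffine.addY x₁ x₁ y₁ (W.toAffine.slope x₁ x₁ y₁ y₁) := ⟨_, rfl⟩
  have h₂ : W.toAffine.Nonsingular x₂ y₂ := by
    rw [hx₂, hy₂d]; exact Affine.nonsingular_add h₁ h₁ fun hxy => hy₁ hxy.right
  have h2Q' : (Affine.Point.some x₁ y₁ h₁ : W.toAffine.Point) + Affine.Point.some x₁ y₁ h₁ =
      Affine.Point.some x₂ y₂ h₂ := by
    rw [h2Q]
    simp only [hx₂, hy₂d]
  -- `2Q` is not `2`-torsion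
  have hy₂ : y₂ ≠ W.toAffine.negY x₂ y₂ := by
    intro hy
    have h4 : (Affine.Point.some x₂ y₂ h₂ : W.toAffine.Point) + Affine.Point.some x₂ y₂ h₂ = 0 :=
      Affine.Point.add_self_of_Y_eq hy
    apply hQ0
    have : (Affine.Point.some x₁ y₁ h₁ : W.toAffine.Point) =
        5 • Affine.Point.some x₁ y₁ h₁
          - ((Affine.Point.some x₁ y₁ h₁ + Affine.Point.some x₁ y₁ h₁)
            + (Affine.Point.some x₁ y₁ h₁ + Affine.Point.some x₁ y₁ h₁)) := by
      abel
    rw [this, hQ5, h2Q', h4, sub_zero]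
  -- `4Q = (x₄, y₄)` and `4Q = -Q`
  have h4Q := Affine.Point.add_self_of_Y_ne (h₁ := h₂) hy₂
  have h4Q' : (Affine.Point.some x₂ y₂ h₂ : W.toAffine.Point) + Affine.Point.some x₂ y₂ h₂ =
      -Affine.Point.some x₁ y₁ h₁ := by
    rw [← h2Q', eq_neg_iff_add_eq_zero, ← hQ5]
    abel
  have hx₄ : W.toAffine.addX x₂ x₂ (W.toAffine.slope x₂ x₂ y₂ y₂) = x₁ := by
    rw [h4Q, Affine.Point.neg_some] at h4Q'
    exact (Affine.Point.some.inj h4Q').1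
  -- name the atoms at `x₁`
  obtain ⟨τ₁, hτ₁⟩ : ∃ τ : L, τ = 6 * x₁ ^ 2 + W.b₂ * x₁ + W.b₄ := ⟨_, rfl⟩
  obtain ⟨υ₁, hυ₁d⟩ : ∃ υ : L, υ = 4 * x₁ ^ 3 + W.b₂ * x₁ ^ 2 + 2 * W.b₄ * x₁ + W.b₆ := ⟨_, rfl⟩
  obtain ⟨w₁, hw₁d⟩ : ∃ w : L, w = 3 * x₁ ^ 4 + W.b₂ * x₁ ^ 3 + 3 * W.b₄ * x₁ ^ 2 + 3 * W.b₆ * x₁ + W.b₈ :=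
    ⟨_, rfl⟩
  -- `υ₁ ≠ 0`, `w₁ ≠ 0`
  have hυ₁ : υ₁ ≠ 0 := by
    rw [hυ₁d, ← sq_sub_negY_eq_upsilon W h₁.left]
    exact pow_ne_zero 2 (sub_ne_zero.2 hy₁)
  have hw₁ : w₁ ≠ 0 := by
    intro h0
    have hΨ : W.Ψ₃.eval x₁ = 0 := by rw [eval_Ψ₃_eq, ← hw₁d, h0]
    have hord : addOrderOf (Affine.Point.some x₁ y₁ h₁ : W.toAffine.Point) = 3 :=
      (Literature.AlgebraicGeometry.PlaneCurves.addOrderOf_eq_three_iff_Ψ₃_eval_eq_zero W h₁).2 hΨ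
    have hdvd : addOrderOf (Affine.Point.some x₁ y₁ h₁ : W.toAffine.Point) ∣ 5 :=
      addOrderOf_dvd_iff_nsmul_eq_zero.2 hQ5
    rw [hord] at hdvd
    norm_num at hdvd
  -- doubling relations
  have hX2 : x₂ * υ₁ = x₁ * υ₁ - w₁ := by
    rw [hx₂, hυ₁d, hw₁d]; exact addX_self_mul_upsilon W h₁.left hy₁
  have hU2 : (4 * x₂ ^ 3 + W.b₂ * x₂ ^ 2 + 2 * W.b₄ * x₂ + W.b₆) * υ₁ ^ 3 = (τ₁ * w₁ - υ₁ ^ 2) ^ 2 := by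
    have u3 := upsilon_double W x₁
    rw [← hτ₁, ← hυ₁d, ← hw₁d, ← hX2] at u3
    linear_combination u3
  have hW2 : (3 * x₂ ^ 4 + W.b₂ * x₂ ^ 3 + 3 * W.b₄ * x₂ ^ 2 + 3 * W.b₆ * x₂ + W.b₈) * υ₁ ^ 4 =
      w₁ * ((τ₁ * w₁ - υ₁ ^ 2) * υ₁ ^ 2 - w₁ ^ 3 - (τ₁ * w₁ - υ₁ ^ 2) ^ 2) := by
    have u4 := Ψ₃_double W x₁
    rw [← hτ₁, ← hυ₁d, ← hw₁d, ← hX2] at u4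
    linear_combination u4
  -- the second doubling: `(x₁ - x₂)·υ(x₂) = -Ψ₃(x₂)`
  have hX4 : x₁ * (4 * x₂ ^ 3 + W.b₂ * x₂ ^ 2 + 2 * W.b₄ * x₂ + W.b₆) =
      x₂ * (4 * x₂ ^ 3 + W.b₂ * x₂ ^ 2 + 2 * W.b₄ * x₂ + W.b₆)
        - (3 * x₂ ^ 4 + W.b₂ * x₂ ^ 3 + 3 * W.b₄ * x₂ ^ 2 + 3 * W.b₆ * x₂ + W.b₈) := by
    rw [← hx₄]; exact addX_self_mul_upsilon W h₂.left hy₂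
  -- the `5`-division relation `P₄υ² = w³`
  have h5rel : (τ₁ * w₁ - υ₁ ^ 2) * υ₁ ^ 2 = w₁ ^ 3 := by
    have key : w₁ * ((τ₁ * w₁ - υ₁ ^ 2) * υ₁ ^ 2 - w₁ ^ 3) = 0 := by
      have e1 : (x₁ - x₂) * υ₁ * ((4 * x₂ ^ 3 + W.b₂ * x₂ ^ 2 + 2 * W.b₄ * x₂ + W.b₆) * υ₁ ^ 3) =
          -((3 * x₂ ^ 4 + W.b₂ * x₂ ^ 3 + 3 * W.b₄ * x₂ ^ 2 + 3 * W.b₆ * x₂ + W.b₈) * υ₁ ^ 4) := by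
        linear_combination υ₁ ^ 4 * hX4
      rw [hU2, hW2] at e1
      have e2 : (x₁ - x₂) * υ₁ = w₁ := by linear_combination -hX2
      rw [e2] at e1
      linear_combination e1
    exact sub_eq_zero.1 ((mul_eq_zero.1 key).resolve_left hw₁)
  have hIII : τ₁ * w₁ * υ₁ ^ 2 = υ₁ ^ 4 + w₁ ^ 3 := by linear_combination h5rel
  have hP4 : τ₁ * w₁ - υ₁ ^ 2 ≠ 0 := by
    intro h0; rw [h0, zero_mul] at h5rel; exact pow_ne_zero 3 hw₁ h5rel.symm
  -- the hauptmodul `h₁ = Hn/Hd` at `x₁` satisfies the `X₀(5)` equation in `L`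
  have hC := c₄_mul_upsilon_sq W x₁
  have hD := Δ_mul_upsilon_sq W x₁
  rw [← hτ₁, ← hυ₁d, ← hw₁d] at hC hD
  have hA3 := tau_sq_add_four_Ψ₃ W x₁
  rw [← hτ₁, ← hυ₁d, ← hw₁d] at hA3
  have key := X0_five_atom_identity hIII
  rw [← hC, ← hD] at key
  have hυ6 : υ₁ ^ 6 ≠ 0 := pow_ne_zero 6 hυ₁
  have key' : υ₁ ^ 6 * (W.c₄ ^ 3 * (τ₁ * (υ₁ ^ 4 - w₁ ^ 3) - 11 * w₁ ^ 2 * υ₁ ^ 2) * (w₁ ^ 2 * υ₁ ^ 2) ^ 5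
      - ((τ₁ * (υ₁ ^ 4 - w₁ ^ 3) - 11 * w₁ ^ 2 * υ₁ ^ 2) ^ 2
          + 10 * (τ₁ * (υ₁ ^ 4 - w₁ ^ 3) - 11 * w₁ ^ 2 * υ₁ ^ 2) * (w₁ ^ 2 * υ₁ ^ 2)
          + 5 * (w₁ ^ 2 * υ₁ ^ 2) ^ 2) ^ 3 * W.Δ) = 0 := by
    linear_combination key
  have hcl := (mul_eq_zero.1 key').resolve_left hυ6
  have hHd : w₁ ^ 2 * υ₁ ^ 2 ≠ 0 := mul_ne_zero (pow_ne_zero 2 hw₁) (pow_ne_zero 2 hυ₁)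
  have hLeq := X0_five_hauptmodul_div (c := W.c₄ ^ 3) (Δ := W.Δ)
    (Hn := τ₁ * (υ₁ ^ 4 - w₁ ^ 3) - 11 * w₁ ^ 2 * υ₁ ^ 2) (Hd := w₁ ^ 2 * υ₁ ^ 2) hHd
    (by linear_combination hcl)
  -- the same value at `x₂ = x(2Q)`
  obtain ⟨τ₂, hτ₂⟩ : ∃ τ : L, τ = 6 * x₂ ^ 2 + W.b₂ * x₂ + W.b₄ := ⟨_, rfl⟩
  obtain ⟨υ₂, hυ₂d⟩ : ∃ υ : L, υ = 4 * x₂ ^ 3 + W.b₂ * x₂ ^ 2 + 2 * W.b₄ * x₂ + W.b₆ := ⟨_, rfl⟩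
  obtain ⟨w₂, hw₂d⟩ : ∃ w : L, w = 3 * x₂ ^ 4 + W.b₂ * x₂ ^ 3 + 3 * W.b₄ * x₂ ^ 2 + 3 * W.b₆ * x₂ + W.b₈ :=
    ⟨_, rfl⟩
  rw [← hυ₂d] at hU2
  rw [← hw₂d] at hW2
  have hT2 : τ₂ * υ₁ ^ 2 = τ₁ * υ₁ ^ 2 - (12 * x₁ + W.b₂) * w₁ * υ₁ + 6 * w₁ ^ 2 := by
    have : τ₂ * υ₁ ^ 2 = 6 * (x₂ * υ₁) ^ 2 + W.b₂ * (x₂ * υ₁) * υ₁ + W.b₄ * υ₁ ^ 2 := by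
      rw [hτ₂]; ring
    rw [this, hX2, hτ₁]
    ring
  have hinv := X0_five_hauptmodul_invariant (T₂ := τ₂) (U₂ := υ₂) (W₂ := w₂) (m := 12 * x₁ + W.b₂)
    hυ₁ hw₁ hP4 hIII hA3 hT2 hU2 hW2
  -- Galois descent: `σ h₁ = h₁`
  have hfix : ∀ σ : AlgebraicClosure K ≃ₐ[K] AlgebraicClosure K,
      σ (τ₁ * (υ₁ ^ 4 - w₁ ^ 3) / (w₁ ^ 2 * υ₁ ^ 2)) = τ₁ * (υ₁ ^ 4 - w₁ ^ 3) / (w₁ ^ 2 * υ₁ ^ 2) := by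
    intro σ
    have hσb₂ : σ W.b₂ = W.b₂ := by rw [hb₂]; exact σ.commutes _
    have hσb₄ : σ W.b₄ = W.b₄ := by rw [hb₄]; exact σ.commutes _
    have hσb₆ : σ W.b₆ = W.b₆ := by rw [hb₆]; exact σ.commutes _
    have hσb₈ : σ W.b₈ = W.b₈ := by rw [hb₈]; exact σ.commutes _
    -- `σ x₁ ∈ {x₁, x₂}`
    have hx : σ x₁ = x₁ ∨ σ x₁ = x₂ := by
      rcases hσQ σ with h | h | h | h
      · left
        rw [WeierstrassCurve.smul_def, Affine.Point.map_some] at h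
        exact (Affine.Point.some.inj h).1
      · left
        rw [WeierstrassCurve.smul_def, Affine.Point.map_some, Affine.Point.neg_some] at h
        exact (Affine.Point.some.inj h).1
      · right
        rw [WeierstrassCurve.smul_def, Affine.Point.map_some, h2Q'] at h
        exact (Affine.Point.some.inj h).1
      · right
        rw [WeierstrassCurve.smul_def, Affine.Point.map_some, h2Q', Affine.Point.neg_some] at h
        exact (Affine.Point.some.inj h).1
    have push : σ (τ₁ * (υ₁ ^ 4 - w₁ ^ 3) / (w₁ ^ 2 * υ₁ ^ 2)) =
        (6 * σ x₁ ^ 2 + W.b₂ * σ x₁ + W.b₄)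
          * ((4 * σ x₁ ^ 3 + W.b₂ * σ x₁ ^ 2 + 2 * W.b₄ * σ x₁ + W.b₆) ^ 4
            - (3 * σ x₁ ^ 4 + W.b₂ * σ x₁ ^ 3 + 3 * W.b₄ * σ x₁ ^ 2 + 3 * W.b₆ * σ x₁ + W.b₈) ^ 3)
          / ((3 * σ x₁ ^ 4 + W.b₂ * σ x₁ ^ 3 + 3 * W.b₄ * σ x₁ ^ 2 + 3 * W.b₆ * σ x₁ + W.b₈) ^ 2
            * (4 * σ x₁ ^ 3 + W.b₂ * σ x₁ ^ 2 + 2 * W.b₄ * σ x₁ + W.b₆) ^ 2) := by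
      rw [hτ₁, hυ₁d, hw₁d]
      simp only [map_div₀, map_mul, map_sub, map_add, map_pow, map_ofNat, hσb₂, hσb₄, hσb₆, hσb₈]
    rw [push]
    rcases hx with hx | hx
    · rw [hx, hτ₁, hυ₁d, hw₁d]
    · rw [hx, ← hτ₂, ← hυ₂d, ← hw₂d, hinv]
  obtain ⟨h₀, hh₀⟩ := (InfiniteGalois.mem_range_algebraMap_iff_fixed
    (τ₁ * (υ₁ ^ 4 - w₁ ^ 3) / (w₁ ^ 2 * υ₁ ^ 2))).mpr hfix
  refine ⟨h₀ - 11, ?_⟩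
  apply inj
  have hh : algebraMap K L (h₀ - 11) = τ₁ * (υ₁ ^ 4 - w₁ ^ 3) / (w₁ ^ 2 * υ₁ ^ 2) - 11 := by
    rw [map_sub, hh₀, map_ofNat]
  have hsplit : (τ₁ * (υ₁ ^ 4 - w₁ ^ 3) - 11 * w₁ ^ 2 * υ₁ ^ 2) / (w₁ ^ 2 * υ₁ ^ 2) =
      τ₁ * (υ₁ ^ 4 - w₁ ^ 3) / (w₁ ^ 2 * υ₁ ^ 2) - 11 := by
    rw [sub_div, show (11 : L) * w₁ ^ 2 * υ₁ ^ 2 / (w₁ ^ 2 * υ₁ ^ 2) = 11 by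
      rw [mul_assoc, mul_div_assoc, div_self hHd, mul_one]]
  rw [hsplit, ← hh, hc₄, hΔ'] at hLeq
  simpa only [map_mul, map_pow, map_add, map_ofNat] using hLeq

/-- **The `b5`-binder of `BoxBorelFive` gives a `K`-point of `X₀(5)` over `j(E)`.**  For a number
field `K`, `E / 𝓞 K`, and a framing of `E[5]` with all `(1,0)` entries zero (VERBATIM
the mod-`5` hypothesis of `BoxBorelFive`, stmt-Langlands-17835): `∃ h : K,
c₄(E⊗K)³·h = (h² + 10h + 5)³·Δ(E⊗K)` — `E ⊗ K` has a `K`-rational `5`-isogeny and `j(E)` is the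
image `(h²+10h+5)³/h` of a `K`-point of `X₀(5)`, the common factor of Box's four `b5`-curves.  Proof:
`exists_X0_five_hauptmodul_of_borelFive`. [cite: Box2022, Thm. 1.5, §1.1] [cite: SilvermanAEC2009, Ex. 3.7] -/
theorem exists_X0_five_hauptmodul_of_borelFive_framing (K : Type) [Field K] [NumberField K]
    (E : WeierstrassCurve (𝓞 K))
    (h5 : ∃ ρ : Literature.NumberTheory.GaloisRepresentations.FramedGaloisRep K (ZMod 5) 2,
      (∃ e : (E.baseChange K).geomTorsion ((5 : ℕ) : ℤ) ≃+ (Fin 2 → ZMod 5),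
        ∀ (σ : Field.absoluteGaloisGroup K) (P : (E.baseChange K).geomTorsion ((5 : ℕ) : ℤ)),
          e (σ • P) = ((ρ σ : GL (Fin 2) (ZMod 5)) : Matrix (Fin 2) (Fin 2) (ZMod 5)) *ᵥ (e P)) ∧
      (∀ σ : Field.absoluteGaloisGroup K,
        (((ρ σ : GL (Fin 2) (ZMod 5)) : Matrix (Fin 2) (Fin 2) (ZMod 5)) 1 0 = 0))) :
    ∃ h : K, (E.baseChange K).c₄ ^ 3 * h = (h ^ 2 + 10 * h + 5) ^ 3 * (E.baseChange K).Δ := by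
  obtain ⟨ρ, ⟨e, he⟩, hB⟩ := h5
  exact exists_X0_five_hauptmodul_of_borelFive (E.baseChange K) ρ e he hB

end Summit.Langlands.Langlands.Theorems.SqrtFiveQuarticCovers

end
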